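import Literature.NumberTheory.EllipticCurves.NeronComponentIndexTypeIVExact
import Literature.NumberTheory.EllipticCurves.NeronComponentIndexTypeIVstarExact
import HarnessLib

/-!
# LAW L-c3, local kernel: the Tamagawa alternative `c ∈ {1, 3}` at a prime `3 = ϖ` of Kodaira type
# `IV` / `IV*`, read on the invariants `c₆` and `Δ` (route `CyclotomicUntwist`, cruxes K1/K2)

Cell `pub/bsd-wall` (D-0145 line `route-BirchSwinnertonDyer-CyclotomicUntwist`), seat `bsd-line-cycu-p2`
(prover seat 2/3, gen 3), helper toward the cruxes K1 `PSRankOneLowerHalfAtThree`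
(stmt-BirchSwinnertonDyer-21580: binder `¬ 3 ∣ W.tamagawaProduct` of the registered stub
`stub_rung_lowerHalfOnGNine_towerUnit`) and K2 `PSRankOneUpperHalfAtThree` (stmt-21581: "why it might
fail: `c₃ = 3` occurs on IV/IV* rows"). THEOREMS ONLY (no definition, no named fact, no `sorry`);
BSD is not proved by this file and no crux is. DVR half of the census law **L-c3** of the crux memo
`Cruxes/PSRankOneUpperHalfAtThree/K2-TAMAGAWA-AT-3-v1.md` (cycu-p4 g2, 5 592 / 5 592 curves): over a
Henselian DVR `R` in which `3` is a UNIFORMISER, `2` a unit and the residue field is `𝔽₃`-like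
(`x ≠ 0 → x² = 1`; e.g. `ℤ₃`, `𝒪_{ℚ,(3)}`), for an `R`-equation `I` on which Tate's algorithm returns
* type `IV` with `3⁶ ∣ Δ(I)` (the route's rows `v₃(Δ_min) = 6`): `[E(K) : E₀(K)] = 3` **iff
  `c₆(I) = 3⁵·κ` with `κ ≡ 1 (mod 3)`** (`index_eq_three_iff_of_kodairaSymbolOfMinimal_eq_IV`);
* type `IV*` with `3¹⁰ ∥ Δ(I)` (rows `v₃(Δ_min) = 10`): the index is `3` **iff `c₆(I) = 3⁶·κ`,
  `Δ(I) = 3¹⁰·μ` with `κ·μ ≡ 1 (mod 3)`** (`index_eq_three_iff_of_kodairaSymbolOfMinimal_eq_IVstar`).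

PROOF. Silverman's exact alternative "`c = 3` iff the Step-5 / Step-8 quadratic `Y² + γ̄Y − ε̄` has a
root in `k`" is the tree's `LocalIndex.index_eq_three_iff_exists_root_of_normalForm_IV(star)`
(Henselian `R`, cell `b2b-bsdres`) on the normal forms `exists_smul_of_kodairaSymbolOfMinimal_eq_IV(star)`;
over an `𝔽₃`-like field of characteristic `≠ 2` a separable monic quadratic has a root iff its
discriminant is `1` (§1); the discriminant is `b₆/9` (resp. `b₆/81`) and §2 reads it on `c₆`, `Δ` by
ring identities in the normal-form coefficients: type `IV`, `3⁶ ∣ Δ ⟹ 9 ∣ b₂ ⟹ c₆ ≡ −216·b₆ (mod 3⁶)`;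
type `IV*`, `3¹⁰ ∣ Δ ⟹ 81 ∣ b₄ ⟹ c₆/3⁶ ≡ −(b₂/9)³`, `Δ/3¹⁰ ≡ −(b₂/9)³(b₆/81) (mod 3)`. Unit changes of
variables multiply `c₆`, `Δ` by `u⁶`, `u¹² ≡ 1 (mod 3)`. The `ℚ`-level law is the sequel file
`CyclotomicUntwistPSTamagawaThreeLaw.lean`.

References: J. H. Silverman, *Advanced Topics in the Arithmetic of Elliptic Curves*, GTM 151 (1994),
IV.9.4 Steps 5 and 8 (PDF pp. 344, 346) with Rem. IV.9.3 [SilvermanATAEC1994]; J. Tate, LNM 476 (1975)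
§7 [Tate1975]; *AEC* III.1 (formulae) [SilvermanAEC2009].
-/

open scoped Classical

open IsLocalRing Polynomial

-- single-conjunct summit: `Summit.BirchSwinnertonDyer.BirchSwinnertonDyer.…` repeats the name by design
set_option linter.dupNamespace false
set_option autoImplicit false

namespace Summit.BirchSwinnertonDyer.BirchSwinnertonDyer.Theorems.PSTamagawaThree

/-! ### §1 Separable quadratics over an `𝔽₃`-like residue field -/

section Residue

variable {k : Type*} [Field k]

/-- Over a field of characteristic `≠ 2`, the monic quadratic `Y² + gY − e` has a root iff its
discriminant `g² + 4e` is a square (completing the square). [folklore] -/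
theorem exists_root_iff_isSquare_disc (h2 : (2 : k) ≠ 0) (g e : k) :
    (∃ r : k, r ^ 2 + g * r - e = 0) ↔ IsSquare (g ^ 2 + 4 * e) := by
  constructor
  · rintro ⟨r, hr⟩
    exact ⟨2 * r + g, by linear_combination (-4 : k) * hr⟩
  · rintro ⟨s, hs⟩
    obtain ⟨t, ht⟩ : ∃ t : k, 2 * t = 1 := ⟨(2 : k)⁻¹, mul_inv_cancel₀ h2⟩
    refine ⟨(s - g) * t, ?_⟩
    linear_combination (-(t ^ 2)) * hs + (-(g * s * t) + g ^ 2 * t + 2 * e * t + e) * ht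

/-- In an `𝔽₃`-like field (`x ≠ 0 → x² = 1`) a NON-ZERO element is a square iff it is `1`. [folklore] -/
theorem isSquare_iff_eq_one (hk : ∀ x : k, x ≠ 0 → x ^ 2 = 1) {d : k} (hd : d ≠ 0) :
    IsSquare d ↔ d = 1 := by
  constructor
  · rintro ⟨s, hs⟩
    have hs0 : s ≠ 0 := by
      rintro rfl
      exact hd (by rw [hs, mul_zero])
    rw [hs, ← sq, hk s hs0]
  · rintro rfl
    exact ⟨1, (mul_one 1).symm⟩

/-- Over an `𝔽₃`-like field of characteristic `≠ 2`, a SEPARABLE monic quadratic `Y² + gY − e`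
(`g² + 4e ≠ 0`) has a root iff `g² + 4e = 1`. [folklore] -/
theorem exists_root_iff_disc_eq_one (h2 : (2 : k) ≠ 0) (hk : ∀ x : k, x ≠ 0 → x ^ 2 = 1)
    (g e : k) (hdisc : g ^ 2 + 4 * e ≠ 0) :
    (∃ r : k, r ^ 2 + g * r - e = 0) ↔ g ^ 2 + 4 * e = 1 := by
  rw [exists_root_iff_isSquare_disc h2, isSquare_iff_eq_one hk hdisc]

/-- In an `𝔽₃`-like field, `x ≠ 0 → x⁶ = 1` (sixth powers of units are `1`). [folklore] -/
theorem pow_six_eq_one (hk : ∀ x : k, x ≠ 0 → x ^ 2 = 1) {x : k} (hx : x ≠ 0) : x ^ 6 = 1 := by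
  rw [show (6 : ℕ) = 2 * 3 by norm_num, pow_mul, hk x hx, one_pow]

end Residue

/-! ### §2 Valuation bookkeeping on the normal forms (pure ring identities, `3` prime) -/

section NormalForm

variable {R : Type*} [CommRing R] [IsDomain R]

/-- **Type `IV` normal form, `c₆ ≡ −216·b₆ (mod 3⁶)`.** For an equation with `a₁ = 3α`, `a₂ = 3β`,
`a₃ = 3γ`, `a₄ = 9δ`, `a₆ = 9ε` (the Step-5 normal form at the uniformiser `3`) and `γ² + 4ε ∉ (3)`
(`27 ∤ b₆`): if `3⁶ ∣ Δ` then `9 ∣ b₂` and `c₆ = 3⁵·κ` with `κ ≡ γ² + 4ε (mod 3)`. (From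
`Δ ≡ −3⁵·b̃₂²·β·(γ² + 4ε) (mod 3⁶)`, `b̃₂ = b₂/3 ≡ β`.) [cite: SilvermanATAEC1994, IV.9.4 Step 5 (PDF p. 344) and III.1 (formulae for `b₂, b₄, b₆, c₆, Δ`)] -/
theorem exists_c₆_eq_of_normalForm_IV (h3 : Prime (3 : R)) (J : WeierstrassCurve R) {α β γ δ ε : R}
    (h1 : J.a₁ = 3 * α) (h2 : J.a₂ = 3 * β) (hγ : J.a₃ = 3 * γ) (h4 : J.a₄ = 3 ^ 2 * δ)
    (hε : J.a₆ = 3 ^ 2 * ε) (hΔ : (3 : R) ^ 6 ∣ J.Δ) (hE : ¬ (3 : R) ∣ γ ^ 2 + 4 * ε) :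
    ∃ κ : R, J.c₆ = 3 ^ 5 * κ ∧ (3 : R) ∣ κ - (γ ^ 2 + 4 * ε) := by
  have h30 : (3 : R) ≠ 0 := h3.ne_zero
  have hΔeq : J.Δ = 3 ^ 5 * (-((3 * α ^ 2 + 4 * β) ^ 2 * (β * (γ ^ 2 + 4 * ε))) +
      3 * (-((3 * α ^ 2 + 4 * β) ^ 2 * (α ^ 2 * ε - α * γ * δ - δ ^ 2)) - 8 * (2 * δ + α * γ) ^ 3 -
        3 * (γ ^ 2 + 4 * ε) ^ 2 + 3 * (3 * α ^ 2 + 4 * β) * (2 * δ + α * γ) * (γ ^ 2 + 4 * ε))) := by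
    simp only [WeierstrassCurve.Δ, WeierstrassCurve.b₂, WeierstrassCurve.b₄, WeierstrassCurve.b₆,
      WeierstrassCurve.b₈, h1, h2, hγ, h4, hε]
    ring
  obtain ⟨q, hq⟩ := hΔ
  have hG : (3 : R) ∣ -((3 * α ^ 2 + 4 * β) ^ 2 * (β * (γ ^ 2 + 4 * ε))) +
      3 * (-((3 * α ^ 2 + 4 * β) ^ 2 * (α ^ 2 * ε - α * γ * δ - δ ^ 2)) - 8 * (2 * δ + α * γ) ^ 3 -
        3 * (γ ^ 2 + 4 * ε) ^ 2 + 3 * (3 * α ^ 2 + 4 * β) * (2 * δ + α * γ) * (γ ^ 2 + 4 * ε)) := by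
    refine ⟨q, mul_left_cancel₀ (pow_ne_zero 5 h30) ?_⟩
    rw [← hΔeq, hq]; ring
  have hBβE : (3 : R) ∣ (3 * α ^ 2 + 4 * β) ^ 2 * (β * (γ ^ 2 + 4 * ε)) := by
    have h := dvd_sub hG (dvd_mul_right (3 : R)
      (-((3 * α ^ 2 + 4 * β) ^ 2 * (α ^ 2 * ε - α * γ * δ - δ ^ 2)) - 8 * (2 * δ + α * γ) ^ 3 -
        3 * (γ ^ 2 + 4 * ε) ^ 2 + 3 * (3 * α ^ 2 + 4 * β) * (2 * δ + α * γ) * (γ ^ 2 + 4 * ε)))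
    rw [add_sub_cancel_right, dvd_neg] at h
    exact h
  have hB : (3 : R) ∣ 3 * α ^ 2 + 4 * β := by
    rcases h3.dvd_or_dvd hBβE with h | h
    · exact h3.dvd_of_dvd_pow h
    · rcases h3.dvd_or_dvd h with h | h
      · exact dvd_add (dvd_mul_right 3 _) (Dvd.dvd.mul_left h 4)
      · exact absurd h hE
  obtain ⟨B', hB'⟩ := hB
  refine ⟨-3 * B' ^ 3 + 12 * B' * (2 * δ + α * γ) - 8 * (γ ^ 2 + 4 * ε), ?_, ?_⟩
  · have hc₆ : J.c₆ = -27 * (3 * α ^ 2 + 4 * β) ^ 3 +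
        972 * (3 * α ^ 2 + 4 * β) * (2 * δ + α * γ) - 1944 * (γ ^ 2 + 4 * ε) := by
      simp only [WeierstrassCurve.c₆, WeierstrassCurve.b₂, WeierstrassCurve.b₄, WeierstrassCurve.b₆,
        h1, h2, hγ, h4, hε]
      ring
    rw [hc₆, hB']
    ring
  · exact ⟨-B' ^ 3 + 4 * B' * (2 * δ + α * γ) - 3 * (γ ^ 2 + 4 * ε), by ring⟩

/-- **Type `IV*` normal form, `c₆/3⁶ ≡ −(b₂/9)³` and `Δ/3¹⁰ ≡ −(b₂/9)³·(b₆/81) (mod 3)`.** For an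
equation with `a₁ = 3α`, `a₂ = 9β`, `a₃ = 9γ`, `a₄ = 27δ`, `a₆ = 81ε` (the Step-8 normal form at
the uniformiser `3`): if `3¹⁰ ∣ Δ` then `81 ∣ b₄` (`3 ∣ 2δ + αγ`), `c₆ = 3⁶·κ` and `Δ = 3¹⁰·μ`
with `κ ≡ −(α² + 4β)³` and `μ ≡ −(α² + 4β)³·(γ² + 4ε) (mod 3)` (the identity
`4·b₈/3⁶ = (b₂/9)(b₆/81) − (b₄/27)²`). [cite: SilvermanATAEC1994, IV.9.4 Step 8 (PDF p. 346) and III.1 (formulae for `b₂, b₄, b₆, b₈, c₆, Δ`)] -/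
theorem exists_c₆_Δ_eq_of_normalForm_IVstar (h3 : Prime (3 : R)) (J : WeierstrassCurve R)
    {α β γ δ ε : R} (h1 : J.a₁ = 3 * α) (h2 : J.a₂ = 3 ^ 2 * β) (hγ : J.a₃ = 3 ^ 2 * γ)
    (h4 : J.a₄ = 3 ^ 3 * δ) (hε : J.a₆ = 3 ^ 4 * ε) (hΔ : (3 : R) ^ 10 ∣ J.Δ) :
    ∃ κ μ : R, J.c₆ = 3 ^ 6 * κ ∧ J.Δ = 3 ^ 10 * μ ∧ (3 : R) ∣ κ + (α ^ 2 + 4 * β) ^ 3 ∧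
      (3 : R) ∣ μ + (α ^ 2 + 4 * β) ^ 3 * (γ ^ 2 + 4 * ε) := by
  have h30 : (3 : R) ≠ 0 := h3.ne_zero
  have hΔeq : J.Δ = 3 ^ 9 * (-(3 * ((α ^ 2 + 4 * β) ^ 2 *
      (α ^ 2 * ε + 4 * β * ε - α * γ * δ + β * γ ^ 2 - δ ^ 2))) - 8 * (2 * δ + α * γ) ^ 3 -
        9 * (γ ^ 2 + 4 * ε) ^ 2 + 9 * (α ^ 2 + 4 * β) * (2 * δ + α * γ) * (γ ^ 2 + 4 * ε)) := by
    simp only [WeierstrassCurve.Δ, WeierstrassCurve.b₂, WeierstrassCurve.b₄, WeierstrassCurve.b₆,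
      WeierstrassCurve.b₈, h1, h2, hγ, h4, hε]
    ring
  obtain ⟨q, hq⟩ := hΔ
  have hG : (3 : R) ∣ -(3 * ((α ^ 2 + 4 * β) ^ 2 *
      (α ^ 2 * ε + 4 * β * ε - α * γ * δ + β * γ ^ 2 - δ ^ 2))) - 8 * (2 * δ + α * γ) ^ 3 -
        9 * (γ ^ 2 + 4 * ε) ^ 2 + 9 * (α ^ 2 + 4 * β) * (2 * δ + α * γ) * (γ ^ 2 + 4 * ε) := by
    refine ⟨q, mul_left_cancel₀ (pow_ne_zero 9 h30) ?_⟩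
    rw [← hΔeq, hq]; ring
  have hD3 : (3 : R) ∣ (2 * δ + α * γ) ^ 3 := by
    have e : (2 * δ + α * γ) ^ 3 = (-(3 * ((α ^ 2 + 4 * β) ^ 2 *
      (α ^ 2 * ε + 4 * β * ε - α * γ * δ + β * γ ^ 2 - δ ^ 2))) - 8 * (2 * δ + α * γ) ^ 3 -
        9 * (γ ^ 2 + 4 * ε) ^ 2 + 9 * (α ^ 2 + 4 * β) * (2 * δ + α * γ) * (γ ^ 2 + 4 * ε)) +
      3 * (3 * (2 * δ + α * γ) ^ 3 + (α ^ 2 + 4 * β) ^ 2 *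
        (α ^ 2 * ε + 4 * β * ε - α * γ * δ + β * γ ^ 2 - δ ^ 2) + 3 * (γ ^ 2 + 4 * ε) ^ 2 -
          3 * (α ^ 2 + 4 * β) * (2 * δ + α * γ) * (γ ^ 2 + 4 * ε)) := by ring
    rw [e]
    exact dvd_add hG (dvd_mul_right 3 _)
  obtain ⟨D', hD'⟩ := h3.dvd_of_dvd_pow hD3
  refine ⟨-(α ^ 2 + 4 * β) ^ 3 + 12 * (α ^ 2 + 4 * β) * (2 * δ + α * γ) - 24 * (γ ^ 2 + 4 * ε),
    -((α ^ 2 + 4 * β) ^ 2 * (α ^ 2 * ε + 4 * β * ε - α * γ * δ + β * γ ^ 2 - δ ^ 2)) -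
      72 * D' ^ 3 - 3 * (γ ^ 2 + 4 * ε) ^ 2 + 9 * (α ^ 2 + 4 * β) * D' * (γ ^ 2 + 4 * ε),
    ?_, ?_, ?_, ?_⟩
  · simp only [WeierstrassCurve.c₆, WeierstrassCurve.b₂, WeierstrassCurve.b₄, WeierstrassCurve.b₆,
      h1, h2, hγ, h4, hε]
    ring
  · rw [hΔeq]
    linear_combination (3 : R) ^ 9 * (-8 * ((2 * δ + α * γ) ^ 2 + (2 * δ + α * γ) * (3 * D') +
      (3 * D') ^ 2) + 9 * (α ^ 2 + 4 * β) * (γ ^ 2 + 4 * ε)) * hD'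
  · exact ⟨4 * (α ^ 2 + 4 * β) * (2 * δ + α * γ) - 8 * (γ ^ 2 + 4 * ε), by ring⟩
  · refine ⟨3 * (α ^ 2 + 4 * β) ^ 2 * D' ^ 2 - 96 * D' ^ 3 - 4 * (γ ^ 2 + 4 * ε) ^ 2 +
      12 * (α ^ 2 + 4 * β) * D' * (γ ^ 2 + 4 * ε) -
      (-((α ^ 2 + 4 * β) ^ 2 * (α ^ 2 * ε + 4 * β * ε - α * γ * δ + β * γ ^ 2 - δ ^ 2)) -
        72 * D' ^ 3 - 3 * (γ ^ 2 + 4 * ε) ^ 2 + 9 * (α ^ 2 + 4 * β) * D' * (γ ^ 2 + 4 * ε)), ?_⟩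
    linear_combination ((α ^ 2 + 4 * β) ^ 2 * ((2 * δ + α * γ) + 3 * D')) * hD'

end NormalForm

/-! ### §3 The exact Tamagawa alternative at the uniformiser `3`, read on `c₆` and `Δ` -/

section DVR

open Literature.NumberTheory.EllipticCurves Literature.NumberTheory.EllipticCurves.LocalIndex
  Literature.NumberTheory.DiophantineGeometry Literature.NumberTheory.DiophantineGeometry.TateAlgorithm

variable {R : Type*} [CommRing R] [IsDomain R] [IsDiscreteValuationRing R]
  {K : Type*} [Field K] [Algebra R K] [IsFractionRing R K]

/-- Membership in `𝔪ⁿ` is divisibility by `3ⁿ` when `3` is a uniformiser. [folklore] -/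
theorem mem_pow_maximalIdeal_iff_of_three (h3 : Irreducible (3 : R)) (x : R) (n : ℕ) :
    x ∈ maximalIdeal R ^ n ↔ (3 : R) ^ n ∣ x := by
  rw [h3.maximalIdeal_eq, Ideal.span_singleton_pow, Ideal.mem_span_singleton]
/-- Membership in `𝔪` is divisibility by `3` when `3` is a uniformiser. [folklore] -/
theorem mem_maximalIdeal_iff_of_three (h3 : Irreducible (3 : R)) (x : R) :
    x ∈ maximalIdeal R ↔ (3 : R) ∣ x := by
  rw [h3.maximalIdeal_eq, Ideal.mem_span_singleton]

/-- `residue x = residue y` iff `3 ∣ x - y` when `3` is a uniformiser. [folklore] -/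
theorem residue_eq_residue_iff_of_three (h3 : Irreducible (3 : R)) (x y : R) :
    residue R x = residue R y ↔ (3 : R) ∣ x - y := by
  rw [← sub_eq_zero, ← map_sub, residue_eq_zero_iff, mem_maximalIdeal_iff_of_three h3]

/-- The residue of a unit has sixth power `1` in an `𝔽₃`-like residue field. [folklore] -/
theorem residue_units_pow_six (hk : ∀ x : ResidueField R, x ≠ 0 → x ^ 2 = 1) (u : Rˣ) :
    residue R (u : R) ^ 6 = 1 :=
  pow_six_eq_one hk ((residue_ne_zero_iff_isUnit _).mpr u.isUnit)

omit [IsDomain R] [IsDiscreteValuationRing R] in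
/-- `c₆` of an `R`-model: `c₆(I) = u⁶ · c₆(D • I)`. [cite: SilvermanAEC2009, III.1 Table 3.1] -/
theorem c₆_eq_units_pow_mul_c₆_smul (I : WeierstrassCurve R) (D : WeierstrassCurve.VariableChange R) :
    I.c₆ = (D.u : R) ^ 6 * (D • I).c₆ := by
  rw [WeierstrassCurve.variableChange_c₆, ← mul_assoc, ← mul_pow, Units.mul_inv, one_pow, one_mul]

omit [IsDomain R] [IsDiscreteValuationRing R] in
/-- `Δ` of an `R`-model: `Δ(I) = u¹² · Δ(D • I)`. [cite: SilvermanAEC2009, III.1 Table 3.1] -/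
theorem Δ_eq_units_pow_mul_Δ_smul (I : WeierstrassCurve R) (D : WeierstrassCurve.VariableChange R) :
    I.Δ = (D.u : R) ^ 12 * (D • I).Δ := by
  rw [WeierstrassCurve.variableChange_Δ, ← mul_assoc, ← mul_pow, Units.mul_inv, one_pow, one_mul]

/-- **LAW L-c3, local form, type `IV`.** Let `R` be a Henselian discrete valuation ring with
`𝔽₃`-like perfect residue field (`x ≠ 0 → x² = 1`) in which `3` is a uniformiser and `2` a unit, `K`
its fraction field, and `I` an `R`-integral Weierstrass equation on which Tate's algorithm returns type
`IV`, with `3⁶ ∣ Δ(I) ≠ 0`. Then `[E(K) : E₀(K)] = 3` (the alternative "`c = 3` iff `k' = k`" of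
Silverman's Step 5) holds **iff `c₆(I) = 3⁵·κ` with `κ ≡ 1 (mod 3)`**.
[cite: SilvermanATAEC1994, IV.9.4 Step 5 (PDF p. 344; proof pp. 348–349) with Rem. IV.9.3 (PDF p. 341)] -/
theorem index_eq_three_iff_of_kodairaSymbolOfMinimal_eq_IV [HenselianLocalRing R]
    [PerfectField (ResidueField R)] (h3 : Irreducible (3 : R)) (h2 : IsUnit (2 : R))
    (hk : ∀ x : ResidueField R, x ≠ 0 → x ^ 2 = 1) (I : WeierstrassCurve R)
    (hI : I.kodairaSymbolOfMinimal = .IV) (h6 : (3 : R) ^ 6 ∣ I.Δ) (hΔ : I.Δ ≠ 0) :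
    (I.nonsingularReductionSubgroup (integers_valuationRing_valuation R K)).index = 3 ↔
      ∃ κ : R, I.c₆ = 3 ^ 5 * κ ∧ residue R κ = 1 := by
  have h3p : Prime (3 : R) := h3.prime
  have h30 : (3 : R) ≠ 0 := h3.ne_zero
  obtain ⟨D, h1, h2', h3', h4, h6', hb₆⟩ := exists_smul_of_kodairaSymbolOfMinimal_eq_IV I hI
  obtain ⟨α, hα⟩ := (mem_maximalIdeal_iff_of_three h3 _).mp h1
  obtain ⟨β, hβ⟩ := (mem_maximalIdeal_iff_of_three h3 _).mp h2'
  obtain ⟨γ, hγ⟩ := (mem_maximalIdeal_iff_of_three h3 _).mp h3'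
  obtain ⟨δ, hδ⟩ := (mem_pow_maximalIdeal_iff_of_three h3 _ 2).mp h4
  obtain ⟨ε, hε⟩ := (mem_pow_maximalIdeal_iff_of_three h3 _ 2).mp h6'
  have hE : ¬ (3 : R) ∣ γ ^ 2 + 4 * ε := by
    intro hE
    apply hb₆
    rw [mem_pow_maximalIdeal_iff_of_three h3, WeierstrassCurve.b₆, hγ, hε]
    obtain ⟨w, hw⟩ := hE
    exact ⟨w, by linear_combination (9 : R) * hw⟩
  have hdisc : residue R γ ^ 2 + 4 * residue R ε ≠ 0 := by
    intro h0
    apply hE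
    rw [← mem_maximalIdeal_iff_of_three h3, ← residue_eq_zero_iff]
    simpa only [map_add, map_pow, map_mul, map_ofNat] using h0
  have hΔJ : (D • I).Δ ≠ 0 := by
    rw [WeierstrassCurve.variableChange_Δ]
    exact mul_ne_zero (pow_ne_zero _ (Units.ne_zero _)) hΔ
  have h6J : (3 : R) ^ 6 ∣ (D • I).Δ := by
    rw [WeierstrassCurve.variableChange_Δ]
    exact Dvd.dvd.mul_left h6 _
  have h2k : (2 : ResidueField R) ≠ 0 := by
    have h := (residue_ne_zero_iff_isUnit (2 : R)).mpr h2
    rwa [map_ofNat] at h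
  rw [← index_nonsingularReductionSubgroup_smul I D,
    index_eq_three_iff_exists_root_of_normalForm_IV (K := K) (D • I) h1 h2' h3 hγ h4 hε hdisc hΔJ,
    exists_root_iff_disc_eq_one h2k hk _ _ hdisc]
  obtain ⟨κJ, hκJ, hκJE⟩ := exists_c₆_eq_of_normalForm_IV h3p (D • I) hα hβ hγ hδ hε h6J hE
  have hres : residue R κJ = residue R γ ^ 2 + 4 * residue R ε := by
    have h := (residue_eq_residue_iff_of_three h3 _ _).mpr hκJE
    simpa only [map_add, map_pow, map_mul, map_ofNat] using h
  have hIc₆ : I.c₆ = 3 ^ 5 * ((D.u : R) ^ 6 * κJ) := by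
    rw [c₆_eq_units_pow_mul_c₆_smul I D, hκJ]; ring
  have hu6 : residue R (D.u : R) ^ 6 = 1 := residue_units_pow_six hk D.u
  constructor
  · intro hE1
    refine ⟨(D.u : R) ^ 6 * κJ, hIc₆, ?_⟩
    rw [map_mul, map_pow, hu6, one_mul, hres, hE1]
  · rintro ⟨κ, hκ, hκ1⟩
    have hκ' : κ = (D.u : R) ^ 6 * κJ :=
      mul_left_cancel₀ (pow_ne_zero 5 h30) (hκ.symm.trans hIc₆)
    have hκres : residue R κ = residue R κJ := by
      rw [hκ', map_mul, map_pow, hu6, one_mul]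
    rw [← hres, ← hκres, hκ1]

/-- **LAW L-c3, local form, type `IV*`.** Same setting, Tate's algorithm returning type `IV*` on `I`
with `3¹⁰ ∣ Δ(I)` and `3¹¹ ∤ Δ(I)`. Then `[E(K) : E₀(K)] = 3` (Silverman's Step 8 alternative) holds
**iff `c₆(I) = 3⁶·κ` and `Δ(I) = 3¹⁰·μ` with `κ·μ ≡ 1 (mod 3)`**.
[cite: SilvermanATAEC1994, IV.9.4 Step 8 (PDF p. 346; proof pp. 352–353) with Rem. IV.9.3 (PDF p. 341)] -/
theorem index_eq_three_iff_of_kodairaSymbolOfMinimal_eq_IVstar [HenselianLocalRing R]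
    [PerfectField (ResidueField R)] (h3 : Irreducible (3 : R)) (h2 : IsUnit (2 : R))
    (hk : ∀ x : ResidueField R, x ≠ 0 → x ^ 2 = 1) (I : WeierstrassCurve R)
    (hI : I.kodairaSymbolOfMinimal = .IVstar) (h10 : (3 : R) ^ 10 ∣ I.Δ)
    (h11 : ¬ (3 : R) ^ 11 ∣ I.Δ) :
    (I.nonsingularReductionSubgroup (integers_valuationRing_valuation R K)).index = 3 ↔
      ∃ κ μ : R, I.c₆ = 3 ^ 6 * κ ∧ I.Δ = 3 ^ 10 * μ ∧ residue R (κ * μ) = 1 := by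
  have h3p : Prime (3 : R) := h3.prime
  have h30 : (3 : R) ≠ 0 := h3.ne_zero
  have hΔ : I.Δ ≠ 0 := by
    rintro h0
    exact h11 (h0 ▸ dvd_zero _)
  obtain ⟨D, h1, h2', h3', h4, h6', h8⟩ := exists_smul_of_kodairaSymbolOfMinimal_eq_IVstar I hI
  obtain ⟨α, hα⟩ := (mem_maximalIdeal_iff_of_three h3 _).mp h1
  obtain ⟨β, hβ⟩ := (mem_pow_maximalIdeal_iff_of_three h3 _ 2).mp h2'
  obtain ⟨γ, hγ⟩ := (mem_pow_maximalIdeal_iff_of_three h3 _ 2).mp h3'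
  obtain ⟨δ, hδ⟩ := (mem_pow_maximalIdeal_iff_of_three h3 _ 3).mp h4
  obtain ⟨ε, hε⟩ := (mem_pow_maximalIdeal_iff_of_three h3 _ 4).mp h6'
  -- the Step-8 quadratic has distinct roots: `γ̄² + 4ε̄ ≠ 0`
  have hdisc : residue R γ ^ 2 + 4 * residue R ε ≠ 0 := by
    obtain ⟨u, hu⟩ := IsDiscreteValuationRing.associated_of_irreducible R irreducible_uniformizer h3
    have hγ' : (D • I).a₃ = uniformizer R ^ 2 * ((u : R) ^ 2 * γ) := by rw [hγ, ← hu]; ring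
    have hε' : (D • I).a₆ = uniformizer R ^ 4 * ((u : R) ^ 4 * ε) := by rw [hε, ← hu]; ring
    rw [quadraticStep8_eq hγ' hε'] at h8
    unfold distinctRootCount at h8
    have h8' := (card_aroots_toFinset_sq_add_sub_eq_two_iff_ne_zero
      (L := AlgebraicClosure (ResidueField R)) _ _).mp h8
    have hu0 : residue R (u : R) ≠ 0 := (residue_ne_zero_iff_isUnit _).mpr u.isUnit
    intro h0
    apply h8'
    have e : residue R ((u : R) ^ 2 * γ) ^ 2 + 4 * residue R ((u : R) ^ 4 * ε) =
        residue R (u : R) ^ 4 * (residue R γ ^ 2 + 4 * residue R ε) := by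
      simp only [map_mul, map_pow]; ring
    rw [e, h0, mul_zero]
  have hΔJ : (D • I).Δ ≠ 0 := by
    rw [WeierstrassCurve.variableChange_Δ]
    exact mul_ne_zero (pow_ne_zero _ (Units.ne_zero _)) hΔ
  have h10J : (3 : R) ^ 10 ∣ (D • I).Δ := by
    rw [WeierstrassCurve.variableChange_Δ]
    exact Dvd.dvd.mul_left h10 _
  have h2k : (2 : ResidueField R) ≠ 0 := by
    have h := (residue_ne_zero_iff_isUnit (2 : R)).mpr h2
    rwa [map_ofNat] at h
  rw [← index_nonsingularReductionSubgroup_smul I D,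
    index_eq_three_iff_exists_root_of_normalForm_IVstar (K := K) (D • I) h1 h2' h3 hγ h4 hε hdisc
      hΔJ, exists_root_iff_disc_eq_one h2k hk _ _ hdisc]
  obtain ⟨κJ, μJ, hκJ, hμJ, hκB, hμB⟩ :=
    exists_c₆_Δ_eq_of_normalForm_IVstar h3p (D • I) hα hβ hγ hδ hε h10J
  -- residues: `κ̄ = -B̄³`, `μ̄ = -B̄³·Ē`, and `B̄ ≠ 0` from `3¹¹ ∤ Δ`
  have hκres : residue R κJ = -(residue R (α ^ 2 + 4 * β)) ^ 3 := by
    have h := (residue_eq_residue_iff_of_three h3 κJ (-(α ^ 2 + 4 * β) ^ 3)).mpr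
      (by rw [sub_neg_eq_add]; exact hκB)
    simpa only [map_neg, map_pow] using h
  have hμres : residue R μJ =
      -(residue R (α ^ 2 + 4 * β)) ^ 3 * (residue R γ ^ 2 + 4 * residue R ε) := by
    have h := (residue_eq_residue_iff_of_three h3 μJ
      (-((α ^ 2 + 4 * β) ^ 3 * (γ ^ 2 + 4 * ε)))).mpr (by rw [sub_neg_eq_add]; exact hμB)
    simpa only [map_neg, map_mul, map_pow, map_add, map_ofNat, neg_mul] using h
  have hB0 : residue R (α ^ 2 + 4 * β) ≠ 0 := by
    intro hB0
    apply h11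
    rw [Δ_eq_units_pow_mul_Δ_smul I D, hμJ]
    have hμ0 : residue R μJ = 0 := by rw [hμres, hB0]; ring
    obtain ⟨w, hw⟩ := (mem_maximalIdeal_iff_of_three h3 _).mp ((residue_eq_zero_iff _).mp hμ0)
    exact ⟨(D.u : R) ^ 12 * w, by rw [hw]; ring⟩
  have hprod : residue R (κJ * μJ) = residue R γ ^ 2 + 4 * residue R ε := by
    rw [map_mul, hκres, hμres]
    have h6 : residue R (α ^ 2 + 4 * β) ^ 6 = 1 := pow_six_eq_one hk hB0
    linear_combination (residue R γ ^ 2 + 4 * residue R ε) * h6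
  have hIc₆ : I.c₆ = 3 ^ 6 * ((D.u : R) ^ 6 * κJ) := by
    rw [c₆_eq_units_pow_mul_c₆_smul I D, hκJ]; ring
  have hIΔ : I.Δ = 3 ^ 10 * ((D.u : R) ^ 12 * μJ) := by
    rw [Δ_eq_units_pow_mul_Δ_smul I D, hμJ]; ring
  have hu6 : residue R (D.u : R) ^ 6 = 1 := residue_units_pow_six hk D.u
  have hu18 : residue R ((D.u : R) ^ 6 * κJ * ((D.u : R) ^ 12 * μJ)) = residue R (κJ * μJ) := by
    simp only [map_mul, map_pow]
    linear_combination (residue R (D.u : R) ^ 12 * residue R κJ * residue R μJ +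
      residue R (D.u : R) ^ 6 * residue R κJ * residue R μJ + residue R κJ * residue R μJ) * hu6
  constructor
  · intro hE1
    exact ⟨(D.u : R) ^ 6 * κJ, (D.u : R) ^ 12 * μJ, hIc₆, hIΔ, by rw [hu18, hprod, hE1]⟩
  · rintro ⟨κ, μ, hκ, hμ, h1'⟩
    have hκ' : κ = (D.u : R) ^ 6 * κJ :=
      mul_left_cancel₀ (pow_ne_zero 6 h30) (hκ.symm.trans hIc₆)
    have hμ' : μ = (D.u : R) ^ 12 * μJ :=
      mul_left_cancel₀ (pow_ne_zero 10 h30) (hμ.symm.trans hIΔ)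
    rw [← hprod, ← hu18, ← hκ', ← hμ', h1']

end DVR

end Summit.BirchSwinnertonDyer.BirchSwinnertonDyer.Theorems.PSTamagawaThree
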